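import Summits.ValiantsHypothesis.ValiantsHypothesis.Theorems.NcRotParseTreeRank
import HarnessLib

/-!
# Rotation-UPT circuits: `LID_r` and `PERM_{4r}` lower bounds, and the i.o. rung

Helper file 3/3 of the rotation-UPT rung (restricted-models ladder of `CommutativityDial`; item
`PerNotNcVP` untouched). MODEL: rotUPT = rotation-UPT NORMAL FORM: circuits typed by a shape T
in which every product gate multiplies an operand typed by its left child and one typed by its
right child IN EITHER ORDER (GateRot = LLS18 Prop 7 typing + the rotated product); the
conversion of an arbitrary rotUPT circuit (LLS18 §4: all parse trees rotations of one tree) to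
this normal form (gate duplication per node, poly blow-up) is NOT formalised. The class contains
the UPT-NF rung's class IN KERNEL (`GateRot.of_gateTyped`) and the comb-typed circuits; sits
above the SKEW rung (`IsFanInTwo ∧ IsSkew`) ON PAPER ONLY (LLS18 §1; conversion not
formalised). It is inhabited for every `n` by the left-comb circuits computing `PERM_n` as the
sum of `n!` ordered monomials (size ≤ `n · n!`; typed by the left comb, rot-typed via
`GateRot.of_gateTyped`; cf. `NcUniqueParseTree.upt_inhabited`, `NcRotParseTree.rot_inhabited`).
ARGUMENT (`lidPoly_rot`, hard polynomial `LID_r`, `d = 4r`, `θ = (r+1)/3`): the heavy-path walk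
`heavy_walk` finds either (A) a node with context `t ∈ [θ, 2θ-2]` — COVER accounting on the
template `(r, 2r, r)` gives `2^t ≤ 4r · size` — or (B) a node of context `t < θ` whose smaller
child has `m ≥ θ` leaves; by the frame dichotomy `frames_snoc` every block of that child is
anchored within `t` of an end, and INSIDE + OUTSIDE accounting on `(0, 2r, 2r)` (`m + t ≤ 2r`),
resp. COVER + OUTSIDE on `(t, 2r-2t, 2r+t)` (`m + t > 2r`), against the full-rank blocks of
`LID_r` (`le_rank_ivFlat_lidPoly`) gives `2^θ ≤ 4r · size`. `PERM_{4r}` follows by the HWY lift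
(`ncPerPoly_rot`), and `perNotNcRotVP` is the i.o. rung in the binder shape of `PerNotNcVP`;
says nothing about untyped circuits (`PerNotNcVP` itself stays open).
[cite: LagardeLimayeSrinivasan2018, §4 Theorem 17] [cite: LagardeMalodPerifel2019, §3]
[cite: HrubesWigdersonYehudayoff2010, Lemma C.5]
-/

noncomputable section

namespace Summit.ValiantsHypothesis.ValiantsHypothesis.Theorems.NcRotParseTreePermanent

set_option linter.dupNamespace false

open Literature.Computability.AlgebraicComplexity
  Literature.Computability.AlgebraicComplexity.ArithCircuit
  Summit.ValiantsHypothesis.ValiantsHypothesis.Theorems.NcAutomatonIntersection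
  Summit.ValiantsHypothesis.ValiantsHypothesis.Theorems.NcCentralWidth
  Summit.ValiantsHypothesis.ValiantsHypothesis.Theorems.NcBlockForms
  Summit.ValiantsHypothesis.ValiantsHypothesis.Theorems.NcCayleyDeterminant
  Summit.ValiantsHypothesis.ValiantsHypothesis.Theorems.NcSOSPermanent
  Summit.ValiantsHypothesis.ValiantsHypothesis.Theorems.NcSkewPermanent
  Summit.ValiantsHypothesis.ValiantsHypothesis.Theorems.NcUniqueParseTree
  Summit.ValiantsHypothesis.ValiantsHypothesis.Theorems.NcUniqueParseTreeRank
  Summit.ValiantsHypothesis.ValiantsHypothesis.Theorems.NcUniqueParseTreePermanent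
  Summit.ValiantsHypothesis.ValiantsHypothesis.Theorems.NcRotParseTree
  Summit.ValiantsHypothesis.ValiantsHypothesis.Theorems.NcRotParseTreeRank

universe u v w

/-! ## §1 The heavy-path walk -/

/-- The HEAVY-PATH WALK with threshold `θ`: descending into the larger child while the peeled
context stays below `θ`, one reaches either (A) a node with context in `[θ, 2θ-2]`, or (B) a node
of context `< θ` whose smaller child has at least `θ` leaves.
[cite: LagardeLimayeSrinivasan2018, §4 Theorem 17] -/
theorem heavy_walk {θ : ℕ} (T : Shape) (hθ : θ < T.size) :
    ∀ (S : Shape) (π : List Bool), T.sub π = some S → T.size - S.size < θ →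
      (∃ π₀ S₀, T.sub π₀ = some S₀ ∧ θ ≤ T.size - S₀.size ∧ T.size - S₀.size + 2 ≤ 2 * θ) ∨
      (∃ π' l r, T.sub π' = some (.node l r) ∧ T.size - (l.size + r.size) < θ ∧
        ((θ ≤ l.size ∧ l.size ≤ r.size) ∨ (θ ≤ r.size ∧ r.size ≤ l.size))) := by
  intro S
  induction S with
  | leaf => intro _ _ ht; exfalso; simp only [Shape.size] at ht; omega
  | node l r ihl ihr =>
    intro π hS ht
    have hl : T.sub (π ++ [false]) = some l := by simp only [Shape.sub_sub hS, Shape.sub]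
    have hr : T.sub (π ++ [true]) = some r := by simp only [Shape.sub_sub hS, Shape.sub]
    simp only [Shape.size] at ht
    by_cases hlr : l.size ≤ r.size
    · by_cases hc : T.size - r.size < θ
      · exact ihr (π ++ [true]) hr hc
      · by_cases hls : θ ≤ l.size
        · exact Or.inr ⟨π, l, r, hS, ht, Or.inl ⟨hls, hlr⟩⟩
        · exact Or.inl ⟨π ++ [true], r, hr, by omega, by omega⟩
    · by_cases hc : T.size - l.size < θ
      · exact ihl (π ++ [false]) hl hc
      · by_cases hrs : θ ≤ r.size
        · exact Or.inr ⟨π, l, r, hS, ht, Or.inr ⟨hrs, by omega⟩⟩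
        · exact Or.inl ⟨π ++ [false], l, hl, by omega, by omega⟩

/-! ## §2 Rot-typing survives the HWY substitution -/

section SubstIn

variable {R : Type u} [CommSemiring R] {σ : Type v} {τ : Type w}

/-- Rot-typing survives an input substitution by letters and the scalar `0` (gates).
[cite: LagardeLimayeSrinivasan2018, §3 Proposition 7] -/
theorem gateRot_substIn {T : Shape} {ty : ℕ → List Bool} {π : List Bool} {g : Gate R σ}
    (hg : GateRot T ty π g) {φ : σ → τ ⊕ R} (hφ : ∀ x c, φ x = Sum.inr c → c = 0) :
    GateRot T ty π (g.substIn φ) := by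
  cases hg with
  | @sum args h =>
    show GateRot T ty π (.sum (args.map fun a => (a.1, a.2.substIn φ)))
    refine GateRot.sum fun a ha => ?_
    obtain ⟨a', ha', rfl⟩ := List.mem_map.1 ha
    exact opTyped_substIn (h a' ha') hφ
  | @copy u h => exact GateRot.copy (opTyped_substIn h hφ)
  | @mul u u' l r hπ hu hu' =>
    exact GateRot.mul hπ (opTyped_substIn hu hφ) (opTyped_substIn hu' hφ)
  | @rot u u' l r hπ hu hu' =>
    exact GateRot.rot hπ (opTyped_substIn hu hφ) (opTyped_substIn hu' hφ)

/-- Rot-typing survives an input substitution by letters and the scalar `0` (all gates).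
[cite: LagardeLimayeSrinivasan2018, §3 Proposition 7] -/
theorem gates_substIn_rot {T : Shape} {ty : ℕ → List Bool} (P : ArithCircuit R σ)
    (hg : ∀ k (hk : k < P.gates.length), GateRot T ty (ty k) P.gates[k]) {φ : σ → τ ⊕ R}
    (hφ : ∀ x c, φ x = Sum.inr c → c = 0) :
    ∀ k (hk : k < (P.substIn φ).gates.length), GateRot T ty (ty k) (P.substIn φ).gates[k] := by
  intro k hk
  simp only [ArithCircuit.substIn, List.getElem_map, List.length_map] at hk ⊢
  exact gateRot_substIn (hg k hk) hφ

end SubstIn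

/-! ## §3 The `LID_r` lower bound -/

section Main

variable (K : Type u) [Field K]

/-- Bookkeeping for the bodies of type `π₀`: they are gate values, homogeneous of degree `|S₀|`.
[cite: LagardeLimayeSrinivasan2018, §4 Lemma 15] -/
theorem bodies_spec {σ : Type v} (P : ArithCircuit K σ) {T : Shape} {ty : ℕ → List Bool}
    (hg : ∀ k (hk : k < P.gates.length), GateRot T ty (ty k) P.gates[k]) {π₀ : List Bool}
    {S₀ : Shape} (hS₀ : T.sub π₀ = some S₀) :
    (ncGateValues P.gates).length = P.gates.length ∧
    (∀ g ∈ tyBodies P.gates ty π₀, ∃ j, j < (ncGateValues P.gates).length ∧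
      g = (ncGateValues P.gates).getD j 0) ∧
    (∀ g ∈ tyBodies P.gates ty π₀, degPart T.size S₀.size g = g) := by
  have hlen : (ncGateValues P.gates).length = P.gates.length := by
    simpa using (ncGateValues_append_getD P.gates []).1
  exact ⟨hlen, fun g ⟨j, hj, _, hgj⟩ => ⟨j, by omega, hgj⟩, fun g ⟨j, hj, hty, hgj⟩ => by
    rw [hgj]; exact (rot_typed_hom P.gates hg j hj).2 S₀ (by rw [hty]; exact hS₀)⟩

/-- Arithmetic of the accounting: `2^n ≤ s · c · 2^e`, `x + e ≤ n`, `θ ≤ x`, `c ≤ B` give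
`2^θ ≤ B · s`. [folklore] -/
theorem pow_le_of_split {θ n x e s c B : ℕ} (h : 2 ^ n ≤ s * (c * 2 ^ e)) (hn : x + e ≤ n)
    (hx : θ ≤ x) (hc : c ≤ B) : 2 ^ θ ≤ B * s := by
  have h1 : 2 ^ x * 2 ^ e ≤ s * c * 2 ^ e := by
    rw [← pow_add, mul_assoc]
    exact (Nat.pow_le_pow_right (by norm_num) hn).trans h
  calc 2 ^ θ ≤ 2 ^ x := Nat.pow_le_pow_right (by norm_num) hx
    _ ≤ s * c := Nat.le_of_mul_le_mul_right h1 (Nat.two_pow_pos e)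
    _ ≤ s * B := Nat.mul_le_mul_left _ hc
    _ = B * s := mul_comm _ _

/-- The shape of a rot-typed circuit computing `LID_r` has `4r` leaves (homogeneity).
[cite: LagardeLimayeSrinivasan2018, §4 Lemma 15] -/
theorem size_eq_of_lid {r : ℕ} (P : ArithCircuit K (Fin 2)) {T : Shape} {ty : ℕ → List Bool}
    (hg : ∀ k (hk : k < P.gates.length), GateRot T ty (ty k) P.gates[k])
    (ho : OpTyped T ty [] P.output) (h : P.ncEval = lidPoly K r) : T.size = 4 * r := by
  have hlen := (bodies_spec K P hg (Shape.sub_nil T)).1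
  by_contra hne
  have hdeg := (opTyped_hom ho (ncGateValues P.gates)
    (fun j hj => rot_typed_hom P.gates hg j (by omega))).2 T (Shape.sub_nil T)
  rw [show P.output.ncEval (ncGateValues P.gates) = P.ncEval from rfl, h,
    degPart_self_lidPoly K hne] at hdeg
  exact lidPoly_ne_zero K r hdeg.symm

/-- A rot-typed circuit computing `LID_r` (`r ≥ 1`) has at least one gate.
[cite: LagardeLimayeSrinivasan2018, §4 Theorem 17] -/
theorem one_le_size {r : ℕ} (hr : 1 ≤ r) (P : ArithCircuit K (Fin 2)) {T : Shape}
    {ty : ℕ → List Bool} (hg : ∀ k (hk : k < P.gates.length), GateRot T ty (ty k) P.gates[k])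
    (ho : OpTyped T ty [] P.output) (h : P.ncEval = lidPoly K r) : 1 ≤ P.size := by
  have hT := size_eq_of_lid K P hg ho h
  by_contra h0
  have h0' : ¬ 1 ≤ P.gates.length := h0
  have hnil : P.gates = [] := List.eq_nil_of_length_eq_zero (by omega)
  have hv : P.ncEval = P.output.ncEval [] := by
    show P.output.ncEval (ncGateValues P.gates) = _
    rw [hnil]; rfl
  rw [h] at hv
  generalize P.output = o at ho hv
  cases ho with
  | @gate j hj => exact lidPoly_ne_zero K r (by rw [hv]; rfl)
  | @var x hx =>
    rw [Shape.sub_nil, Option.some.injEq] at hx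
    subst hx
    simp only [Shape.size] at hT
    exact absurd hT (Nat.ne_of_lt (Nat.lt_of_lt_of_le (by norm_num)
      (Nat.le_mul_of_pos_right 4 hr)))
  | zero =>
    exact lidPoly_ne_zero K r (by
      rw [hv]; show algebraMap K (FreeAlgebra K (Fin 2)) 0 = 0; exact map_zero _)

/-- CASE (B) of the walk: at a node `π'` of context `t < θ`, the smaller child `S₀ = π' · c`
(`θ ≤ m = |S₀|`, `2m ≤ |node|`) forces `2^θ ≤ 4r · size` — its blocks are anchored within `t` of
an end (`frames_snoc`), and INSIDE + OUTSIDE accounting on `(0, 2r, 2r)` (`m + t ≤ 2r`), resp.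
COVER + OUTSIDE accounting on `(t, 2r-2t, 2r+t)` (`m + t > 2r`), meets the full-rank blocks of
`LID_r`. [cite: LagardeLimayeSrinivasan2018, §4 Theorem 17] [cite: LagardeMalodPerifel2019, §3] -/
theorem lid_caseB {r θ : ℕ} (P : ArithCircuit K (Fin 2)) {T : Shape} {ty : ℕ → List Bool}
    (hg : ∀ k (hk : k < P.gates.length), GateRot T ty (ty k) P.gates[k])
    (ho : OpTyped T ty [] P.output) (h : P.ncEval = lidPoly K r) (hT : T.size = 4 * r)
    {π' : List Bool} {lS rS : Shape} (hπ' : T.sub π' = some (.node lS rS)) (c : Bool)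
    {S₀ : Shape} (hS₀ : T.sub (π' ++ [c]) = some S₀) (hm2 : 2 * S₀.size ≤ lS.size + rS.size)
    (hθm : θ ≤ S₀.size) (t : ℕ) (ht : t + (lS.size + rS.size) = T.size) (htθ : t < θ)
    (hθr : 3 * θ ≤ r + 1) (hθ2 : 2 ≤ θ) : 2 ^ θ ≤ 4 * r * P.gates.length := by
  obtain ⟨hlen, hBv, hB⟩ := bodies_spec K P hg hS₀
  have hmem := output_mem_rotSpan P hg ho hS₀ (by omega)
  rw [h] at hmem
  have hF : ∀ p ∈ frames T (π' ++ [c]), p.1 + S₀.size + p.2 = T.size ∧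
      (p.1 + (lS.size + rS.size) ≤ T.size ∨ p.2 + (lS.size + rS.size) ≤ T.size) := fun p hp =>
    ⟨frames_total hS₀ hp, by simpa only [Shape.size] using frames_snoc hπ' c hp⟩
  by_cases hB1 : S₀.size + t ≤ 2 * r
  · -- INSIDE + OUTSIDE on the template `(0, 2r, 2r)`
    obtain ⟨f₁, hf₁, f₂, hf₂, hf⟩ :=
      rotSpan_split K (frames T (π' ++ [c])) (fun p : ℕ × ℕ => p.1 + S₀.size ≤ 2 * r) hmem
    have h2 := rank_ivFlat_inside_le K (a := 0) (ℓ := 2 * r) (b := 2 * r) (m := S₀.size)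
      (by omega) (by omega) (ncGateValues P.gates) hBv hB
      (fun p hp => by
        obtain ⟨hp, hP⟩ := Finset.mem_filter.1 hp
        have hP : p.1 + S₀.size ≤ 2 * r := hP
        have := hF p hp; omega) hf₁
    have h1 := rank_ivFlat_outside_le K (a := 0) (ℓ := 2 * r) (b := 2 * r) (m := S₀.size)
      (by omega) (by omega) (ncGateValues P.gates) hBv hB
      (fun p hp => by
        obtain ⟨hp, hP⟩ := Finset.mem_filter.1 hp
        have hP : ¬ p.1 + S₀.size ≤ 2 * r := hP
        have := hF p hp; omega) hf₂
    have hlow := le_rank_ivFlat_lidPoly K (r := r) (a := 0) (ℓ := 2 * r) (b := 2 * r)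
      (by omega) (by omega)
    have hsum := rank_ivFlat_add_le K 0 (2 * r) (2 * r) f₁ f₂
    rw [hf] at hsum
    rw [Fintype.card_fin, hlen] at h1 h2
    refine pow_le_of_split (θ := θ) (hlow.trans (hsum.trans ?_))
      (show S₀.size + (2 * r - S₀.size) ≤ 2 * r by omega) hθm
      (show 2 * (2 * r - S₀.size + 1) ≤ 4 * r by omega)
    calc _ ≤ _ := add_le_add h2 h1
      _ = P.gates.length * (2 * (2 * r - S₀.size + 1) * 2 ^ (2 * r - S₀.size)) := by ring
  · -- COVER + OUTSIDE on the template `(t, 2r - 2t, 2r + t)`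
    obtain ⟨f₁, hf₁, f₂, hf₂, hf⟩ :=
      rotSpan_split K (frames T (π' ++ [c])) (fun p : ℕ × ℕ => p.1 ≤ t) hmem
    have h3 := rank_ivFlat_cover_le K (a := t) (ℓ := 2 * r - 2 * t) (b := 2 * r + t)
      (m := S₀.size) (by omega) (by omega) (ncGateValues P.gates) hBv hB
      (fun p hp => by
        obtain ⟨hp, hP⟩ := Finset.mem_filter.1 hp
        have hP : p.1 ≤ t := hP
        have := hF p hp; omega) hf₁
    have h1 := rank_ivFlat_outside_le K (a := t) (ℓ := 2 * r - 2 * t) (b := 2 * r + t)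
      (m := S₀.size) (by omega) (by omega) (ncGateValues P.gates) hBv hB
      (fun p hp => by
        obtain ⟨hp, hP⟩ := Finset.mem_filter.1 hp
        have hP : ¬ p.1 ≤ t := hP
        have := hF p hp; omega) hf₂
    have hlow := le_rank_ivFlat_lidPoly K (r := r) (a := t) (ℓ := 2 * r - 2 * t)
      (b := 2 * r + t) (by omega) (by omega)
    have hsum := rank_ivFlat_add_le K t (2 * r - 2 * t) (2 * r + t) f₁ f₂
    rw [hf] at hsum
    rw [Fintype.card_fin, hlen] at h1 h3
    have hu : (S₀.size - (2 * r - 2 * t) + 1) * 2 ^ (S₀.size - (2 * r - 2 * t)) ≤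
        (2 * t + 1) * 2 ^ (3 * t) :=
      Nat.mul_le_mul (by omega) (Nat.pow_le_pow_right (by norm_num) (by omega))
    have hv : 2 ^ t * ((2 * r + t - S₀.size + 1) * 2 ^ (2 * r + t - S₀.size)) ≤
        (2 * t + 1) * 2 ^ (3 * t) :=
      calc _ ≤ 2 ^ t * ((2 * t + 1) * 2 ^ (2 * t)) := Nat.mul_le_mul_left _
            (Nat.mul_le_mul (by omega) (Nat.pow_le_pow_right (by norm_num) (by omega)))
        _ = (2 * t + 1) * 2 ^ (3 * t) := by ring
    refine pow_le_of_split (θ := θ) (hlow.trans (hsum.trans ?_))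
      (show (2 * r - 5 * t - 1) + (3 * t + 1) ≤ 2 * r - 2 * t by omega)
      (show θ ≤ 2 * r - 5 * t - 1 by omega) (show 2 * t + 1 ≤ 4 * r by omega)
    calc _ ≤ _ := add_le_add h3 h1
      _ ≤ P.gates.length * ((2 * t + 1) * 2 ^ (3 * t)) +
          P.gates.length * ((2 * t + 1) * 2 ^ (3 * t)) :=
        add_le_add (Nat.mul_le_mul_left _ hu) (Nat.mul_le_mul_left _ hv)
      _ = P.gates.length * ((2 * t + 1) * 2 ^ (3 * t + 1)) := by ring

/-- **ROTATION-UPT LOWER BOUND FOR `LID_r`**: size ≥ 2^{(r+1)/3} / (4r). MODEL: rotUPT =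
rotation-UPT NORMAL FORM: circuits typed by a shape T in which every product gate multiplies an
operand typed by its left child and one typed by its right child IN EITHER ORDER (GateRot =
LLS18 Prop 7 typing + the rotated product); the conversion of an arbitrary rotUPT circuit
(LLS18 §4: all parse trees rotations of one tree) to this normal form (gate duplication per
node, poly blow-up) is NOT formalised. Proof: `θ = (r+1)/3`; `θ ≤ 1` by `one_le_size`; else
the walk `heavy_walk` ends in case (A) — COVER accounting on `(r, 2r, r)` — or case (B) —
`lid_caseB`. [cite: LagardeLimayeSrinivasan2018, §4 Theorem 17]
[cite: LagardeMalodPerifel2019, §3] -/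
theorem lidPoly_rot {r : ℕ} (hr : 1 ≤ r) (P : ArithCircuit K (Fin 2)) {T : Shape}
    {ty : ℕ → List Bool} (hg : ∀ k (hk : k < P.gates.length), GateRot T ty (ty k) P.gates[k])
    (ho : OpTyped T ty [] P.output) (h : P.ncEval = lidPoly K r) :
    2 ^ ((r + 1) / 3) ≤ 4 * r * P.size := by
  have h1 := one_le_size K hr P hg ho h
  by_cases hθ1 : (r + 1) / 3 ≤ 1
  · calc 2 ^ ((r + 1) / 3) ≤ 2 ^ 1 := Nat.pow_le_pow_right (by norm_num) hθ1
      _ ≤ 4 * r * 1 := by rw [pow_one]; omega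
      _ ≤ 4 * r * P.size := Nat.mul_le_mul_left _ h1
  have hT := size_eq_of_lid K P hg ho h
  show 2 ^ ((r + 1) / 3) ≤ 4 * r * P.gates.length
  rcases heavy_walk (θ := (r + 1) / 3) T (by omega) T [] (Shape.sub_nil T) (by omega) with
    ⟨π₀, S₀, hS₀, hA1, hA2⟩ | ⟨π', lS, rS, hπ', ht, hor⟩
  · -- case (A): COVER accounting on the template `(r, 2r, r)`
    obtain ⟨hlen, hBv, hB⟩ := bodies_spec K P hg hS₀
    have hle := Shape.off_add_size_le hS₀
    have hmem := output_mem_rotSpan P hg ho hS₀ (by omega)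
    rw [h] at hmem
    have h3 := rank_ivFlat_cover_le K (a := r) (ℓ := 2 * r) (b := r) (m := S₀.size)
      (by omega) (by omega) (ncGateValues P.gates) hBv hB
      (fun p hp => by have := frames_total hS₀ hp; omega) hmem
    have hlow := le_rank_ivFlat_lidPoly K (r := r) (a := r) (ℓ := 2 * r) (b := r)
      (by omega) (by omega)
    rw [Fintype.card_fin, hlen] at h3
    exact pow_le_of_split (hlow.trans h3)
      (show T.size - S₀.size + (S₀.size - 2 * r) ≤ 2 * r by omega) hA1
      (show S₀.size - 2 * r + 1 ≤ 4 * r by omega)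
  · have hl : T.sub (π' ++ [false]) = some lS := by simp only [Shape.sub_sub hπ', Shape.sub]
    have hr' : T.sub (π' ++ [true]) = some rS := by simp only [Shape.sub_sub hπ', Shape.sub]
    have hle := Shape.off_add_size_le hπ'
    simp only [Shape.size] at hle
    rcases hor with ⟨hθl, hlr⟩ | ⟨hθr, hrl⟩
    · exact lid_caseB K P hg ho h hT hπ' false hl (by omega) hθl
        (T.size - (lS.size + rS.size)) (by omega) ht (by omega) (by omega)
    · exact lid_caseB K P hg ho h hT hπ' true hr' (by omega) hθr
        (T.size - (lS.size + rS.size)) (by omega) ht (by omega) (by omega)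

/-- **ROTATION-UPT LOWER BOUND FOR `PERM_{4r}`** via the HWY lift (MODEL: rotUPT =
rotation-UPT NORMAL FORM: circuits typed by a shape T in which every product gate multiplies an
operand typed by its left child and one typed by its right child IN EITHER ORDER (GateRot =
LLS18 Prop 7 typing + the rotated product); the conversion of an arbitrary rotUPT circuit
(LLS18 §4: all parse trees rotations of one tree) to this normal form (gate duplication per
node, poly blow-up) is NOT formalised): substitute by `liftSubst` (rot-typing preserved, size
unchanged, value `LID_r` by `perm_lift`) and apply `lidPoly_rot`.
[cite: LagardeLimayeSrinivasan2018, §4 Theorem 17]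
[cite: HrubesWigdersonYehudayoff2010, Lemma C.5] -/
theorem ncPerPoly_rot {r : ℕ} (hr : 1 ≤ r) (P : ArithCircuit K (Fin (4 * r) × Fin (4 * r)))
    {T : Shape} {ty : ℕ → List Bool}
    (hg : ∀ k (hk : k < P.gates.length), GateRot T ty (ty k) P.gates[k])
    (ho : OpTyped T ty [] P.output) (h : P.ncEval = ncPerPoly K (4 * r)) :
    2 ^ ((r + 1) / 3) ≤ 4 * r * P.size := by
  have hφ : ∀ x c, liftSubst K r (4 * r) x = Sum.inr c → c = 0 := liftSubst_inr K
  have hQ : (P.substIn (liftSubst K r (4 * r))).ncEval = lidPoly K r := by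
    rw [ncEval_substIn, h, perm_lift K (le_refl (4 * r))]
  have := lidPoly_rot K hr (P.substIn (liftSubst K r (4 * r))) (gates_substIn_rot P hg hφ)
    (opTyped_substIn ho hφ) hQ
  rwa [size_substIn] at this

end Main

/-! ## §4 The i.o. rung for rotation-UPT circuits -/

/-- Growth bookkeeping: `12j · ((12j)^c + c) < 2^j` for `j = 2^{4c+6}`. [folklore] -/
theorem rot_growth (c : ℕ) : ∃ j : ℕ, 1 ≤ j ∧ 12 * j * ((12 * j) ^ c + c) < 2 ^ j := by
  have h1 : 2 * c + 3 < 2 ^ (2 * c + 3) := Nat.lt_two_pow_self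
  have h2 : 4 * c ^ 2 + 15 * c + 11 ≤ 2 ^ ((2 * c + 3) * 2) :=
    calc 4 * c ^ 2 + 15 * c + 11 ≤ (2 * c + 4) ^ 2 := by nlinarith
      _ ≤ (2 ^ (2 * c + 3)) ^ 2 := Nat.pow_le_pow_left (by omega) 2
      _ = 2 ^ ((2 * c + 3) * 2) := (pow_mul 2 (2 * c + 3) 2).symm
  refine ⟨2 ^ ((2 * c + 3) * 2), Nat.one_le_two_pow, ?_⟩
  generalize hk : (2 * c + 3) * 2 = k at h2 ⊢
  have hE : k + 4 + (c + (k + 4) * c) < 2 ^ k := by subst hk; nlinarith [h2]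
  have hc1 : c + 1 ≤ 2 ^ c := Nat.lt_two_pow_self
  have h16 : 12 * 2 ^ k ≤ 2 ^ (k + 4) := by rw [show 2 ^ (k + 4) = 2 ^ k * 16 by ring]; omega
  have hX : 1 ≤ (12 * 2 ^ k) ^ c := Nat.one_le_pow _ _ (by positivity)
  calc 12 * 2 ^ k * ((12 * 2 ^ k) ^ c + c)
      ≤ 2 ^ (k + 4) * (2 ^ c * (2 ^ (k + 4)) ^ c) := by
        apply Nat.mul_le_mul h16
        have := Nat.mul_le_mul_left c hX
        calc (12 * 2 ^ k) ^ c + c ≤ (c + 1) * (12 * 2 ^ k) ^ c := by rw [add_mul, one_mul]; omega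
          _ ≤ 2 ^ c * (2 ^ (k + 4)) ^ c := Nat.mul_le_mul hc1 (Nat.pow_le_pow_left h16 c)
    _ = 2 ^ (k + 4 + (c + (k + 4) * c)) := by rw [← pow_mul, ← pow_add, ← pow_add]
    _ < 2 ^ 2 ^ k := Nat.pow_lt_pow_right (by norm_num) hE

/-- **THE I.O. RUNG IN THE BINDER SHAPE OF `PerNotNcVP`, FOR ROTATION-UPT CIRCUITS** (MODEL:
rotUPT = rotation-UPT NORMAL FORM: circuits typed by a shape T in which every product gate
multiplies an operand typed by its left child and one typed by its right child IN EITHER ORDER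
(GateRot = LLS18 Prop 7 typing + the rotated product); the conversion of an arbitrary rotUPT
circuit (LLS18 §4: all parse trees rotations of one tree) to this normal form (gate duplication
per node, poly blow-up) is NOT formalised): for every `c` there is an `n` (`n = 4(3j-1)`,
`12j((12j)^c + c) < 2^j`) such that no rot-typed noncommutative circuit of size `≤ n^c + c` —
of any shape and typing — computes `PERM_n` over `ℂ`. The class contains the UPT-NF rung's class
IN KERNEL (`GateRot.of_gateTyped`) and the comb-typed circuits (among them the left-comb
circuits computing `PERM_n`, size `≤ n · n!`); sits above the SKEW rung (`IsFanInTwo ∧ IsSkew`)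
ON PAPER ONLY (LLS18 §1; conversion not formalised). Says nothing about untyped circuits
(`PerNotNcVP` itself stays open). [cite: LagardeLimayeSrinivasan2018, §4 Theorem 17]
[cite: LimayeMalodSrinivasan2016, §7] -/
theorem perNotNcRotVP (c : ℕ) : ∃ n : ℕ, ∀ (P : ArithCircuit ℂ (Fin n × Fin n)) (T : Shape)
    (ty : ℕ → List Bool), (∀ k (hk : k < P.gates.length), GateRot T ty (ty k) P.gates[k]) →
    OpTyped T ty [] P.output → P.ncEval = ncPerPoly ℂ n → n ^ c + c < P.size := by
  obtain ⟨j, hj, hlt⟩ := rot_growth c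
  refine ⟨4 * (3 * j - 1), fun P T ty hg ho h => ?_⟩
  have hle := ncPerPoly_rot ℂ (r := 3 * j - 1) (by omega) P hg ho h
  rw [show (3 * j - 1 + 1) / 3 = j by omega] at hle
  by_contra hcon
  have h1 := Nat.mul_le_mul_left (4 * (3 * j - 1)) (Nat.not_lt.1 hcon)
  have h2 : 4 * (3 * j - 1) * ((4 * (3 * j - 1)) ^ c + c) ≤ 12 * j * ((12 * j) ^ c + c) :=
    Nat.mul_le_mul (by omega) (Nat.add_le_add_right (Nat.pow_le_pow_left (by omega) c) c)
  omega

end Summit.ValiantsHypothesis.ValiantsHypothesis.Theorems.NcRotParseTreePermanent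

end
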